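import Summits.QuantumFields.BalabanUV.Beta.FP.BubbleGermValue

/-!
# `BalabanUV.Beta.FP.PolarizationColour` — road «FP» for binder row D1, leaf H2-ASM-4 (COLOUR ∕ NORMALISATION): THE COLOUR WEIGHTS OF THE
# GERM-LEVEL POLARIZATION AGAINST AN3'S DICTIONARY, WITH THE `cQ`-BOOKKEEPING DISPLAYED — finite algebra over `Fin 4` on the tree's closed forms

HONEST DEPENDENCY (page 1, mandatory): continuum YM on T⁴ ⇐ BetaPertH ∧ nine spine estimates (0/9 proved); BetaPertH ⇐ (D1) ∧ (D4) ∧ CAP+tail;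
G-an2-4 gates asym, D1 and NE2/3/4.  HONEST FRAMING (cell contract, verbatim): «discharging `BetaPertH` makes Bałaban's UV stability UNCONDITIONAL —
a real constructive-QFT result; it is NOT the continuum limit and NOT the Clay problem.»  THIS MODULE DISCHARGES NOTHING of the wall: it is FINITE
ALGEBRA on `FP/BubbleGermValue`'s germ bubble `bubble`, ghost loop `ghostLoop` and the closed forms `gluonBubble = (10∕3)·T`, `ghostBubble = T∕3`,
`kappaBal N = (22∕3)·N²c₄²` of `BubbleTransfer` ∕ `LeadingCoefficient`; no lattice, no limit, no estimate; 0 `def`, 0 `def … : Prop`, nothing cited,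
0 sorry; NOT `hrem`, NOT `hgerm`, NOT D1, NOT BetaPertH, NOT continuum, NOT Clay.
ABSOLUTE RULE (cell charter, verbatim): «No internally-minted statement may enter as a cited fact. Every hypothesis is either kernel-proved in this package or a
verbatim quotation of a PUBLISHED theorem with page reference. The manuscript(s) under audit are NOT citable for their own disputed steps — they are the thing
under adjudication; programme-internal (2001/route/tribunal) claims are never citable.»  Every statement below is an identity ∕ equivalence of explicit finite sums.

WHAT ROW H2-ASM-4 ASKS (owner memo `H2V-DESIGN.md` f78878bd5f8d2d18 §4, R-FP-23; object H2V-0 `FP/PerfectPolarization.PiBF wg wgh V W v w μ ν z :=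
wg·hessKer Pker V W μ ν z − wgh·hessKer G0ker v w μ ν z`, p240631, weights `wg wgh` PARAMETERS «pinned by row H2-ASM-4»): the germ of `PiBF` is, after H2-ASM-3,
`wg·cL²·𝔅[cubic germ] − wgh·cG²·𝔊` with `𝔅[L] = aB·bubble L L` and `𝔊 = aG·ghostLoop` (the antisymmetrisation factors `aB, aG` are the letters H2-ASM-3 DISPLAYS;
`cL, cG` the leg constants: `Pker`'s field block `= c₄′·(c₄ℓ₀·δ) + O(‖z‖⁻³)` by (K0), so `cL = c₄′·c₄`; `G0ker = latticeGreen∕2 = c₄ℓ₀ + O(‖z‖⁻⁴)`, so `cG = c₄`);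
the cubic germ of the total family is `cQ·bfGerm` (H2V-1∕2: `cubicGermOf V3 = cQ·ymGerm` by `CubicGermExchange`, slice matched); FIX `w_g, w_gh` so that the
germ equals an3's realised background-field kernel `2N²c₄²·(¼·bubble bfGerm bfGerm + ghostLoop)` (= `piBal N = kappaBal N·T`, dictionary (D3) `E = −Ω`, (D4) `×2N`
of `BubbleTransfer.piBal`), whence `·x_λx_{λ′} = leadingIntegrand (kappaBal N)` (`germ_hval`).  HERE the weights are LETTERS `wg wgh : ℝ` (cell work-order (P6):
colour constants BY VALUE, pinned last) and the module proves WHICH values do it: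
* §1 [folklore] the germ bubble is BILINEAR in the two germs (`bubble_smul`, `bubble_add_left∕right`); `cQ • bfGerm = famGerm cQ cQ`;
* §2 [folklore] CLOSED FORM: for ALL weights and letters the germ-level polarization is `κ·T` with `κ = (40·wg·aB·(cL·cQ)² − wgh·aG·cG²)∕3` (`germPol_eq`), so its
  (1.22)-moment is ALWAYS `leadingIntegrand κ` (`germPol_moment`) — the weights only set `κ`;
* §3 [folklore] THE NORMALISATION: total matching `κ = kappaBal N` ⟺ `40·wg·aB·(cL·cQ)² − wgh·aG·cG² = 22·N²·c₄²` (`germPol_eq_piBal_iff`, ONE equation in two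
  weights — `total_not_sector` shows it does not fix them); an3's LABELLED SECTORS (`germ_sectors`: gluon `8N²T − 4N²S`, ghost `+2N²S`) matched separately ⟺
  `4·wg·aB·(cL·cQ)² = 2N²c₄²` ∧ `−wgh·aG·cG² = 2N²c₄²` (`gluonSector_iff`, `ghostSector_iff`) ⟺ **`wg = N²c₄²∕(2·aB·(cL·cQ)²)`, `wgh = −2N²c₄²∕(aG·cG²)`**
  (`sector_iff_weights`; at canonical legs `cL·cQ = cG = c₄`: `wg = N²∕(2aB)`, `wgh = −2N²∕aG`, `weights_canonical`); sectors ⟹ total;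
* §4 [folklore] THE END FACE of the row: under sector matching `wg·cL²·𝔅[cQ·bfGerm] − wgh·cG²·𝔊 = 2N²c₄²·(¼·bubble bfGerm bfGerm + ghostLoop)` on `E4 ∖ 0`, ALL `λ λ′`
  (`germPol_eq_an3`), `= contBubble univ (bfCoeff N) (bfP h) (bfQ h)` for `λ ≠ λ′` (`germPol_eq_contBubble`), `·x_λx_{λ′} = leadingIntegrand (kappaBal N)` (`germPol_hval`);
* §5 [folklore] THE `cQ`-BOOKKEEPING, LOCATED (memo §3 «H2-ASM-4 displays this bookkeeping explicitly»): (a) MATCHED LEGS `cL = cP∕cQ` (legs = inverse of the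
  `cQ`-scaled form): the germ-level polarization is `cQ`-FREE (`germPol_matchedLegs`); (b) FIXED legs, matched slice, weights pinned at `cQ = 1`: `κ(cQ) =
  ((10·cQ² + 1)∕11)·kappaBal N` (`kappa_fixedLegs`) — NOT `cQ²·kappaBal N` (the ghost loop carries no `cQ`; `ratio_eq_sq_iff`: equal iff `cQ² = 1`); (c) UNMATCHED
  slice (germ `cQ·ymGerm + sliceGerm = famGerm cQ 1`): the gluon germ bubble is `covFamily (−20cQ² − 20cQ) (44cQ² + 32cQ + 4)`, divergence-free iff `cQ = 1`
  (`unmatched_divFree_iff`), yet its OFF-DIAGONAL moment is still a leading germ, `leadingIntegrand ((11cQ² + 8cQ + 1)∕6)` (`unmatched_gluon_moment`; the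
  `δ_{λλ′}` defect is invisible to `λ ≠ λ′`).  For the perfect data `cQ = 1` (`PerfectSymbol166.W166lim_zero`, not used here) all three readings coincide.
WHAT IT IS NOT: it does not construct `PiBF` (H2V-0, owner), does not prove the kernel-to-germ expansion or display `aB, aG` (H2-ASM-3), does not bound a remainder
(H2-ASM-1∕2∕5); it is the finite algebra those rows are wired through.  Provenance: b2b-balaban-t4-ne9-formalise-leaf-03 gen 31, 2026-08-20, row H2-ASM-4 (R-FP-23 (c)).
-/

namespace Summit.QuantumFields.BalabanUV.Beta.FP.PolarizationColour

open Finset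
open scoped BigOperators
open Summit.QuantumFields.BalabanUV.Beta.FP.MarginalUniqueness
open Summit.QuantumFields.BalabanUV.Beta.FP.BubbleGermValue
open Literature.MathematicalPhysics.QuantumFieldTheory.Balaban1983to89.Beta.TransverseStructure
open Literature.MathematicalPhysics.QuantumFieldTheory.Balaban1983to89.Beta.TransverseLink
open Literature.MathematicalPhysics.QuantumFieldTheory.Balaban1983to89.Beta.BubbleTransfer
open Literature.MathematicalPhysics.QuantumFieldTheory.Balaban1983to89.Beta.LeadingCoefficient
open Literature.MathematicalPhysics.QuantumFieldTheory.Balaban1983to89.Beta.SquareTable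

noncomputable section

/-! ## §1 Bilinearity of the germ bubble; the matched family as a scalar multiple -/

/-- [folklore] The direct Wick channel is homogeneous in each germ. -/
theorem bubbleDirect_smul (a b : ℝ) (L L' : CubicGerm) (lam lam' : Idx) (x : E4) :
    bubbleDirect (a • L) (b • L') lam lam' x = a * b * bubbleDirect L L' lam lam' x := by
  unfold bubbleDirect
  have h : ∀ (i i' : Fin 2) (κ κ' : Idx),
      (∑ μ, ∑ ν, (a • L) μ ν lam κ i * (b • L') μ ν lam' κ' i') * legW x i i' κ κ'
        = a * b * ((∑ μ, ∑ ν, L μ ν lam κ i * L' μ ν lam' κ' i') * legW x i i' κ κ') := by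
    intro i i' κ κ'
    simp only [Pi.smul_apply, smul_eq_mul, Finset.mul_sum, Finset.sum_mul]
    exact Finset.sum_congr rfl fun μ _ => Finset.sum_congr rfl fun ν _ => by ring
  simp_rw [h]
  simp only [Finset.mul_sum]

/-- [folklore] The crossed Wick channel is homogeneous in each germ. -/
theorem bubbleCrossed_smul (a b : ℝ) (L L' : CubicGerm) (lam lam' : Idx) (x : E4) :
    bubbleCrossed (a • L) (b • L') lam lam' x = a * b * bubbleCrossed L L' lam lam' x := by
  unfold bubbleCrossed
  have h : ∀ (i i' : Fin 2) (κ κ' : Idx),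
      (∑ μ, ∑ ν, (a • L) μ ν lam κ i * (b • L') ν μ lam' κ' i') * legWx x i i' κ κ'
        = a * b * ((∑ μ, ∑ ν, L μ ν lam κ i * L' ν μ lam' κ' i') * legWx x i i' κ κ') := by
    intro i i' κ κ'
    simp only [Pi.smul_apply, smul_eq_mul, Finset.mul_sum, Finset.sum_mul]
    exact Finset.sum_congr rfl fun μ _ => Finset.sum_congr rfl fun ν _ => by ring
  simp_rw [h]
  simp only [Finset.mul_sum]

/-- [folklore] **The germ bubble is homogeneous of degree (1,1)**: `bubble (a•L) (b•L′) = a·b·bubble L L′` — so H2-ASM-3's `𝔅[L] = aB·bubble L L` is QUADRATIC: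
`𝔅[cQ·L] = cQ²·𝔅[L]`. -/
theorem bubble_smul (a b : ℝ) (L L' : CubicGerm) (lam lam' : Idx) (x : E4) :
    bubble (a • L) (b • L') lam lam' x = a * b * bubble L L' lam lam' x := by
  rw [bubble, bubble, bubbleDirect_smul, bubbleCrossed_smul]; ring

/-- [folklore] The direct channel is additive in the first germ. -/
theorem bubbleDirect_add_left (L₁ L₂ L' : CubicGerm) (lam lam' : Idx) (x : E4) :
    bubbleDirect (L₁ + L₂) L' lam lam' x = bubbleDirect L₁ L' lam lam' x + bubbleDirect L₂ L' lam lam' x := by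
  unfold bubbleDirect
  simp only [Pi.add_apply, add_mul, Finset.sum_add_distrib]

/-- [folklore] The direct channel is additive in the second germ. -/
theorem bubbleDirect_add_right (L L₁' L₂' : CubicGerm) (lam lam' : Idx) (x : E4) :
    bubbleDirect L (L₁' + L₂') lam lam' x = bubbleDirect L L₁' lam lam' x + bubbleDirect L L₂' lam lam' x := by
  unfold bubbleDirect
  simp only [Pi.add_apply, mul_add, add_mul, Finset.sum_add_distrib]

/-- [folklore] The crossed channel is additive in the first germ. -/
theorem bubbleCrossed_add_left (L₁ L₂ L' : CubicGerm) (lam lam' : Idx) (x : E4) :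
    bubbleCrossed (L₁ + L₂) L' lam lam' x = bubbleCrossed L₁ L' lam lam' x + bubbleCrossed L₂ L' lam lam' x := by
  unfold bubbleCrossed
  simp only [Pi.add_apply, add_mul, Finset.sum_add_distrib]

/-- [folklore] The crossed channel is additive in the second germ. -/
theorem bubbleCrossed_add_right (L L₁' L₂' : CubicGerm) (lam lam' : Idx) (x : E4) :
    bubbleCrossed L (L₁' + L₂') lam lam' x = bubbleCrossed L L₁' lam lam' x + bubbleCrossed L L₂' lam lam' x := by
  unfold bubbleCrossed
  simp only [Pi.add_apply, mul_add, add_mul, Finset.sum_add_distrib]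

/-- [folklore] **The germ bubble is additive in the first germ.** -/
theorem bubble_add_left (L₁ L₂ L' : CubicGerm) (lam lam' : Idx) (x : E4) :
    bubble (L₁ + L₂) L' lam lam' x = bubble L₁ L' lam lam' x + bubble L₂ L' lam lam' x := by
  rw [bubble, bubble, bubble, bubbleDirect_add_left, bubbleCrossed_add_left]; ring

/-- [folklore] **The germ bubble is additive in the second germ.** -/
theorem bubble_add_right (L L₁' L₂' : CubicGerm) (lam lam' : Idx) (x : E4) :
    bubble L (L₁' + L₂') lam lam' x = bubble L L₁' lam lam' x + bubble L L₂' lam lam' x := by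
  rw [bubble, bubble, bubble, bubbleDirect_add_right, bubbleCrossed_add_right]; ring

/-- [our object] The two-parameter family as a linear combination: `famGerm c s = c•ymGerm + s•sliceGerm` (the shape H2V-1∕2 deliver: `cubicGermOf V3 = cQ•ymGerm`,
`cubicGermOf sliceA = sliceGerm`). -/
theorem famGerm_eq_lincomb (c s : ℝ) : famGerm c s = c • ymGerm + s • sliceGerm := by
  funext μ ν lam κ i; simp [famGerm]

/-- [our object] The MATCHED family (slice weight = `cQ`) is the scalar multiple `cQ • bfGerm = famGerm cQ cQ`. -/
theorem smul_bfGerm_eq_fam (cQ : ℝ) : cQ • bfGerm = famGerm cQ cQ := by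
  funext μ ν lam κ i; simp [bfGerm, famGerm, mul_add]

/-- [folklore] `bubble (cQ•bfGerm) (cQ•bfGerm) = (40∕3)·cQ²·T` at every `z ≠ 0`, ALL `λ λ′` (`bubble_bfGerm`: `= 4·gluonBubble`, `gluonBubble = (10∕3)·T`). -/
theorem bubble_smul_bfGerm (cQ : ℝ) (lam lam' : Idx) {x : E4} (hx : x ≠ 0) :
    bubble (cQ • bfGerm) (cQ • bfGerm) lam lam' x = (40 / 3 : ℝ) * cQ ^ 2 * transverse lam lam' x := by
  rw [bubble_smul, bubble_bfGerm lam lam' hx, gluonBubble_eq]; ring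

/-- [folklore] `ghostLoop = T∕3` (`ghostLoop_eq`, `ghostBubble_eq`). -/
theorem ghostLoop_eq_third (lam lam' : Idx) (x : E4) : ghostLoop lam lam' x = (1 / 3 : ℝ) * transverse lam lam' x := by
  rw [ghostLoop_eq, ghostBubble_eq]

/-- [folklore] `kappaBal N = (22∕3)·N²·c₄²` (`11N²∕(24π⁴)` with `c₄² = 1∕(16π⁴)`): an3's `2N²c₄²` times the background-field `11∕3`. -/
theorem kappaBal_eq_c4 (N : ℝ) : kappaBal N = (22 / 3 : ℝ) * N ^ 2 * c4 ^ 2 := by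
  rw [kappaBal, c4_sq]; ring

/-! ## §2 The germ-level polarization with lettered weights: closed form `κ·T`, and its (1.22)-moment -/

/-- [folklore] **CLOSED FORM FOR ALL WEIGHTS AND LETTERS** (`z ≠ 0`, ALL `λ λ′`):
`wg·cL²·(aB·bubble (cQ•bfGerm) (cQ•bfGerm)) − wgh·cG²·(aG·ghostLoop) = ((40·wg·aB·(cL·cQ)² − wgh·aG·cG²)∕3)·T_{λλ′}(z)` — the germ-level polarization is ALWAYS a
multiple of the transverse structure; the colour weights only set the scalar. -/
theorem germPol_eq (wg wgh aB aG cL cG cQ : ℝ) (lam lam' : Idx) {x : E4} (hx : x ≠ 0) :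
    wg * cL ^ 2 * (aB * bubble (cQ • bfGerm) (cQ • bfGerm) lam lam' x) - wgh * cG ^ 2 * (aG * ghostLoop lam lam' x)
      = (40 * wg * aB * (cL * cQ) ^ 2 - wgh * aG * cG ^ 2) / 3 * transverse lam lam' x := by
  rw [bubble_smul_bfGerm cQ lam lam' hx, ghostLoop_eq_third]; ring

/-- [folklore] **… so its `λ ≠ λ′` (1.22)-moment is ALWAYS a leading germ**: `x_λx_{λ′}·(germ-level polarization) = leadingIntegrand ((40·wg·aB·(cL·cQ)² − wgh·aG·cG²)∕3) λ λ′ x`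
(`TransverseLink.smul_moment_eq_leadingIntegrand`). -/
theorem germPol_moment (wg wgh aB aG cL cG cQ : ℝ) {lam lam' : Idx} (h : lam ≠ lam') {x : E4} (hx : x ≠ 0) :
    x lam * x lam' * (wg * cL ^ 2 * (aB * bubble (cQ • bfGerm) (cQ • bfGerm) lam lam' x) - wgh * cG ^ 2 * (aG * ghostLoop lam lam' x))
      = leadingIntegrand ((40 * wg * aB * (cL * cQ) ^ 2 - wgh * aG * cG ^ 2) / 3) lam lam' x := by
  rw [germPol_eq wg wgh aB aG cL cG cQ lam lam' hx, smul_moment_eq_leadingIntegrand h]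

/-- [folklore] A test point: `T_{01}(1,1,1,1) = 3∕32 ≠ 0`. -/
theorem transverse_01_ones : transverse 0 1 (fun _ : Fin 4 => (1 : ℝ)) = 3 / 32 := by
  rw [transverse_eq, if_neg (by decide)]
  simp [r2]
  norm_num

/-- [folklore] `(1,1,1,1) ≠ 0`. -/
theorem ones_ne_zero : (fun _ : Fin 4 => (1 : ℝ)) ≠ 0 := by
  intro h0; have := congrFun h0 0; simp at this

/-! ## §3 The normalisation: total matching, an3's labelled sectors, the solved weights -/

/-- [folklore] **TOTAL MATCHING** against an3's realised kernel `piBal N = kappaBal N·T` ((D3) `E = −Ω`, (D4) `×2N`; `BubbleTransfer.piBal_eq`): the germ-level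
polarization equals `kappaBal N·T` on `E4 ∖ 0` for all `λ λ′` **iff** `(40·wg·aB·(cL·cQ)² − wgh·aG·cG²)∕3 = kappaBal N` (= `(22∕3)·N²c₄²`, `kappaBal_eq_c4`) — ONE
equation in the two weights. -/
theorem germPol_eq_piBal_iff (wg wgh aB aG cL cG cQ N : ℝ) :
    (∀ lam lam' : Idx, ∀ x : E4, x ≠ 0 →
        wg * cL ^ 2 * (aB * bubble (cQ • bfGerm) (cQ • bfGerm) lam lam' x) - wgh * cG ^ 2 * (aG * ghostLoop lam lam' x)
          = kappaBal N * transverse lam lam' x)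
      ↔ (40 * wg * aB * (cL * cQ) ^ 2 - wgh * aG * cG ^ 2) / 3 = kappaBal N := by
  constructor
  · intro hall
    have h01 := hall 0 1 _ ones_ne_zero
    rw [germPol_eq wg wgh aB aG cL cG cQ 0 1 ones_ne_zero, transverse_01_ones] at h01
    exact mul_right_cancel₀ (by norm_num : (3 / 32 : ℝ) ≠ 0) h01
  · intro h lam lam' x hx
    rw [germPol_eq wg wgh aB aG cL cG cQ lam lam' hx, h]

/-- [folklore] **GLUON SECTOR** (an3's labelled `8N²T − 4N²S = 2N²c₄²·gluonBubble∕c₄²…`, `germ_sectors`): `wg·cL²·aB·bubble (cQ•bfGerm)² = 2N²c₄²·(¼·bubble bfGerm bfGerm)`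
on `E4 ∖ 0` for all `λ λ′` **iff** `4·wg·aB·(cL·cQ)² = 2·N²·c₄²`. -/
theorem gluonSector_iff (wg aB cL cQ N : ℝ) :
    (∀ lam lam' : Idx, ∀ x : E4, x ≠ 0 →
        wg * cL ^ 2 * (aB * bubble (cQ • bfGerm) (cQ • bfGerm) lam lam' x)
          = 2 * N ^ 2 * c4 ^ 2 * ((1 / 4 : ℝ) * bubble bfGerm bfGerm lam lam' x))
      ↔ 4 * wg * aB * (cL * cQ) ^ 2 = 2 * N ^ 2 * c4 ^ 2 := by
  constructor
  · intro hall
    have h01 := hall 0 1 _ ones_ne_zero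
    rw [bubble_smul_bfGerm cQ 0 1 ones_ne_zero, quarter_bubble_bfGerm 0 1 ones_ne_zero, gluonBubble_eq, transverse_01_ones] at h01
    linear_combination (16 / 5 : ℝ) * h01
  · intro h lam lam' x hx
    rw [bubble_smul_bfGerm cQ lam lam' hx, quarter_bubble_bfGerm lam lam' hx, gluonBubble_eq]
    linear_combination (10 / 3 * transverse lam lam' x) * h

/-- [folklore] **GHOST SECTOR** (an3's labelled `+2N²S`): `−wgh·cG²·aG·ghostLoop = 2N²c₄²·ghostLoop` on `E4 ∖ 0` for all `λ λ′` **iff** `−wgh·aG·cG² = 2·N²·c₄²`. -/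
theorem ghostSector_iff (wgh aG cG N : ℝ) :
    (∀ lam lam' : Idx, ∀ x : E4, x ≠ 0 →
        -(wgh * cG ^ 2 * (aG * ghostLoop lam lam' x)) = 2 * N ^ 2 * c4 ^ 2 * ghostLoop lam lam' x)
      ↔ -(wgh * aG * cG ^ 2) = 2 * N ^ 2 * c4 ^ 2 := by
  constructor
  · intro hall
    have h01 := hall 0 1 _ ones_ne_zero
    rw [ghostLoop_eq_third, transverse_01_ones] at h01
    linear_combination (32 : ℝ) * h01
  · intro h lam lam' x hx
    linear_combination (ghostLoop lam lam' x) * h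

/-- [folklore] **SECTORS ⟹ TOTAL**: the two sector equations imply the total normalisation `κ = kappaBal N`. -/
theorem total_of_sectors {wg wgh aB aG cL cG cQ N : ℝ} (hg : 4 * wg * aB * (cL * cQ) ^ 2 = 2 * N ^ 2 * c4 ^ 2)
    (hgh : -(wgh * aG * cG ^ 2) = 2 * N ^ 2 * c4 ^ 2) :
    (40 * wg * aB * (cL * cQ) ^ 2 - wgh * aG * cG ^ 2) / 3 = kappaBal N := by
  rw [kappaBal_eq_c4]; linear_combination (10 / 3 : ℝ) * hg + (1 / 3 : ℝ) * hgh

/-- [folklore] **… NOT CONVERSELY** (located): the total equation does not fix the weights — at `aB = aG = cL = cG = cQ = 1` the pair `wg = 0`, `wgh = −22N²c₄²`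
satisfies the total normalisation while the gluon sector equation fails whenever `N ≠ 0`.  (an3's LABELLED sectors, i.e. (D3)(D4) read sector by sector, are what
pin both weights.) -/
theorem total_not_sector {N : ℝ} (hN : N ≠ 0) :
    ∃ wg wgh : ℝ, (40 * wg * 1 * ((1 : ℝ) * 1) ^ 2 - wgh * 1 * (1 : ℝ) ^ 2) / 3 = kappaBal N ∧
      ¬ 4 * wg * 1 * ((1 : ℝ) * 1) ^ 2 = 2 * N ^ 2 * c4 ^ 2 := by
  refine ⟨0, -(22 * N ^ 2 * c4 ^ 2), by rw [kappaBal_eq_c4]; ring, fun h => ?_⟩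
  have hc : (0 : ℝ) < 2 * N ^ 2 * c4 ^ 2 := by have := c4_pos; positivity
  linarith

/-- [folklore] **THE SOLVED WEIGHTS**: with the H2-ASM-3 letters and leg constants non-zero, sector matching ⟺
`wg = N²c₄²∕(2·aB·(cL·cQ)²)` ∧ `wgh = −2N²c₄²∕(aG·cG²)`. -/
theorem sector_iff_weights {aB aG cL cG cQ : ℝ} (haB : aB ≠ 0) (haG : aG ≠ 0) (hL : cL * cQ ≠ 0) (hG : cG ≠ 0) (wg wgh N : ℝ) :
    (4 * wg * aB * (cL * cQ) ^ 2 = 2 * N ^ 2 * c4 ^ 2 ∧ -(wgh * aG * cG ^ 2) = 2 * N ^ 2 * c4 ^ 2)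
      ↔ (wg = N ^ 2 * c4 ^ 2 / (2 * aB * (cL * cQ) ^ 2) ∧ wgh = -(2 * N ^ 2 * c4 ^ 2) / (aG * cG ^ 2)) := by
  have hL2 : (cL * cQ) ^ 2 ≠ 0 := pow_ne_zero 2 hL
  have hG2 : cG ^ 2 ≠ 0 := pow_ne_zero 2 hG
  have hd1 : 2 * aB * (cL * cQ) ^ 2 ≠ 0 := mul_ne_zero (mul_ne_zero two_ne_zero haB) hL2
  have hd2 : aG * cG ^ 2 ≠ 0 := mul_ne_zero haG hG2
  constructor
  · rintro ⟨h1, h2⟩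
    refine ⟨(eq_div_iff hd1).mpr ?_, (eq_div_iff hd2).mpr ?_⟩
    · linear_combination (1 / 2 : ℝ) * h1
    · linear_combination (-1 : ℝ) * h2
  · rintro ⟨h1, h2⟩
    rw [eq_div_iff hd1] at h1
    rw [eq_div_iff hd2] at h2
    exact ⟨by linear_combination (2 : ℝ) * h1, by linear_combination (-1 : ℝ) * h2⟩

/-- [folklore] **AT CANONICAL LEGS** (`cL·cQ = c₄` — gluon legs `c₄ℓ₀δ` — and `cG = c₄`): sector matching ⟺ `wg = N²∕(2·aB)` ∧ `wgh = −2N²∕aG` — «explicit rationals × N-powers»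
once H2-ASM-3 displays `aB, aG`. -/
theorem weights_canonical {aB aG cL cQ : ℝ} (haB : aB ≠ 0) (haG : aG ≠ 0) (hL : cL * cQ = c4) (wg wgh N : ℝ) :
    (4 * wg * aB * (cL * cQ) ^ 2 = 2 * N ^ 2 * c4 ^ 2 ∧ -(wgh * aG * c4 ^ 2) = 2 * N ^ 2 * c4 ^ 2)
      ↔ (wg = N ^ 2 / (2 * aB) ∧ wgh = -(2 * N ^ 2) / aG) := by
  have hc : c4 ≠ 0 := c4_pos.ne'
  have hc2 : c4 ^ 2 ≠ 0 := pow_ne_zero 2 hc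
  rw [sector_iff_weights haB haG (by rw [hL]; exact hc) hc wg wgh N, hL]
  have e1 : N ^ 2 * c4 ^ 2 / (2 * aB * c4 ^ 2) = N ^ 2 / (2 * aB) := by field_simp
  have e2 : -(2 * N ^ 2 * c4 ^ 2) / (aG * c4 ^ 2) = -(2 * N ^ 2) / aG := by field_simp
  rw [e1, e2]

/-! ## §4 The row's END face: under sector matching the germ-level polarization IS an3's realised background-field kernel -/

/-- [folklore] **H2-ASM-4 END FACE** (`z ≠ 0`, ALL `λ λ′`): gluon and ghost sectors matched ⟹
`wg·cL²·(aB·bubble (cQ•bfGerm) (cQ•bfGerm)) − wgh·cG²·(aG·ghostLoop) = 2N²c₄²·(¼·bubble bfGerm bfGerm + ghostLoop)` — the left side of `BubbleGermValue.germ_hval` ∕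
`germ_value_eq_piBal` ∕ `germ_sectors`.  (The owner memo's display carries an overall `cQ²` on the right; with the ghost loop `cQ`-free that shape is this one exactly
at `cQ² = 1` — §5.) -/
theorem germPol_eq_an3 {wg wgh aB aG cL cG cQ N : ℝ} (hg : 4 * wg * aB * (cL * cQ) ^ 2 = 2 * N ^ 2 * c4 ^ 2)
    (hgh : -(wgh * aG * cG ^ 2) = 2 * N ^ 2 * c4 ^ 2) (lam lam' : Idx) {x : E4} (hx : x ≠ 0) :
    wg * cL ^ 2 * (aB * bubble (cQ • bfGerm) (cQ • bfGerm) lam lam' x) - wgh * cG ^ 2 * (aG * ghostLoop lam lam' x)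
      = 2 * N ^ 2 * c4 ^ 2 * ((1 / 4 : ℝ) * bubble bfGerm bfGerm lam lam' x + ghostLoop lam lam' x) := by
  rw [bubble_smul_bfGerm cQ lam lam' hx, quarter_bubble_bfGerm lam lam' hx, gluonBubble_eq, ghostLoop_eq_third]
  linear_combination (10 / 3 * transverse lam lam' x) * hg + (1 / 3 * transverse lam lam' x) * hgh

/-- [folklore] **… = `kappaBal N · T`** (Bałaban's orientation and basis, `BubbleTransfer.piBal_eq`). -/
theorem germPol_eq_kappaBal_transverse {wg wgh aB aG cL cG cQ N : ℝ} (hg : 4 * wg * aB * (cL * cQ) ^ 2 = 2 * N ^ 2 * c4 ^ 2)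
    (hgh : -(wgh * aG * cG ^ 2) = 2 * N ^ 2 * c4 ^ 2) (lam lam' : Idx) {x : E4} (hx : x ≠ 0) :
    wg * cL ^ 2 * (aB * bubble (cQ • bfGerm) (cQ • bfGerm) lam lam' x) - wgh * cG ^ 2 * (aG * ghostLoop lam lam' x)
      = kappaBal N * transverse lam lam' x := by
  rw [germPol_eq wg wgh aB aG cL cG cQ lam lam' hx, total_of_sectors hg hgh]

/-- [folklore] **… = an3's REALISED TABLE** `contBubble univ (bfCoeff N) (bfP h) (bfQ h)` for `λ ≠ λ′` (`BubbleGermValue.germ_value_eq_contBubble_bf`). -/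
theorem germPol_eq_contBubble {wg wgh aB aG cL cG cQ N : ℝ} (hg : 4 * wg * aB * (cL * cQ) ^ 2 = 2 * N ^ 2 * c4 ^ 2)
    (hgh : -(wgh * aG * cG ^ 2) = 2 * N ^ 2 * c4 ^ 2) {lam lam' : Idx} (h : lam ≠ lam') {x : E4} (hx : x ≠ 0) :
    wg * cL ^ 2 * (aB * bubble (cQ • bfGerm) (cQ • bfGerm) lam lam' x) - wgh * cG ^ 2 * (aG * ghostLoop lam lam' x)
      = contBubble Finset.univ (bfCoeff N) (bfP h) (bfQ h) x := by
  rw [germPol_eq_an3 hg hgh lam lam' hx, germ_value_eq_contBubble_bf N h hx]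

/-- [folklore] **THE VALUE** (`λ ≠ λ′`, `z ≠ 0`): under sector matching `x_λx_{λ′}·(germ-level polarization) = leadingIntegrand (kappaBal N) λ λ′ x` — the main term of
the consumer's `hrem` (`HorizontalGerm.hgerm_stepBal_of_leadingGerm`, slope `11N²∕(12π²)`), by `BubbleGermValue.germ_hval`. -/
theorem germPol_hval {wg wgh aB aG cL cG cQ N : ℝ} (hg : 4 * wg * aB * (cL * cQ) ^ 2 = 2 * N ^ 2 * c4 ^ 2)
    (hgh : -(wgh * aG * cG ^ 2) = 2 * N ^ 2 * c4 ^ 2) {lam lam' : Idx} (h : lam ≠ lam') {x : E4} (hx : x ≠ 0) :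
    x lam * x lam' * (wg * cL ^ 2 * (aB * bubble (cQ • bfGerm) (cQ • bfGerm) lam lam' x) - wgh * cG ^ 2 * (aG * ghostLoop lam lam' x))
      = leadingIntegrand (kappaBal N) lam lam' x := by
  rw [germPol_eq_an3 hg hgh lam lam' hx]
  exact germ_hval N h hx

/-- [folklore] The same from the TOTAL equation alone (the value needs only `κ = kappaBal N`). -/
theorem germPol_hval_of_total {wg wgh aB aG cL cG cQ N : ℝ} (hn : (40 * wg * aB * (cL * cQ) ^ 2 - wgh * aG * cG ^ 2) / 3 = kappaBal N)
    {lam lam' : Idx} (h : lam ≠ lam') {x : E4} (hx : x ≠ 0) :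
    x lam * x lam' * (wg * cL ^ 2 * (aB * bubble (cQ • bfGerm) (cQ • bfGerm) lam lam' x) - wgh * cG ^ 2 * (aG * ghostLoop lam lam' x))
      = leadingIntegrand (kappaBal N) lam lam' x := by
  rw [germPol_moment wg wgh aB aG cL cG cQ h hx, hn]

/-! ## §5 The `cQ`-bookkeeping, located (memo §3: «the RATIO is what `stepBal` sees — H2-ASM-4 displays this bookkeeping explicitly») -/

/-- [folklore] **(a) MATCHED LEGS ⟹ `cQ`-FREE**: if the gluon legs are the inverse of the `cQ`-scaled quadratic form (`cL = cP∕cQ`), the germ-level polarization does not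
see `cQ` at all: two vertices `cQ²` against two legs `cQ⁻²`. -/
theorem germPol_matchedLegs (wg wgh aB aG cP cG : ℝ) {cQ : ℝ} (hcQ : cQ ≠ 0) (lam lam' : Idx) {x : E4} (hx : x ≠ 0) :
    wg * (cP / cQ) ^ 2 * (aB * bubble (cQ • bfGerm) (cQ • bfGerm) lam lam' x) - wgh * cG ^ 2 * (aG * ghostLoop lam lam' x)
      = wg * cP ^ 2 * (aB * bubble bfGerm bfGerm lam lam' x) - wgh * cG ^ 2 * (aG * ghostLoop lam lam' x) := by
  rw [bubble_smul_bfGerm cQ lam lam' hx, bubble_bfGerm lam lam' hx, gluonBubble_eq]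
  field_simp
  ring

/-- [folklore] **(b) FIXED LEGS, matched slice, weights pinned at `cQ = 1`** (sector equations at `cQ = 1`): the scalar at general `cQ` is
`κ(cQ) = ((10·cQ² + 1)∕11)·kappaBal N` — gluon `10∕11` scales by `cQ²`, ghost `1∕11` does not. -/
theorem kappa_fixedLegs {wg wgh aB aG cL cG N : ℝ} (hg : 4 * wg * aB * (cL * 1) ^ 2 = 2 * N ^ 2 * c4 ^ 2)
    (hgh : -(wgh * aG * cG ^ 2) = 2 * N ^ 2 * c4 ^ 2) (cQ : ℝ) :
    (40 * wg * aB * (cL * cQ) ^ 2 - wgh * aG * cG ^ 2) / 3 = (10 * cQ ^ 2 + 1) / 11 * kappaBal N := by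
  rw [kappaBal_eq_c4]; linear_combination (10 / 3 * cQ ^ 2) * hg + (1 / 3 : ℝ) * hgh

/-- [folklore] … hence (fixed legs) `x_λx_{λ′}·(germ-level polarization at cQ) = leadingIntegrand (((10·cQ² + 1)∕11)·kappaBal N)` — NOT `leadingIntegrand (cQ²·kappaBal N)`
unless `cQ² = 1` (`ratio_eq_sq_iff`). -/
theorem germPol_hval_fixedLegs {wg wgh aB aG cL cG N : ℝ} (hg : 4 * wg * aB * (cL * 1) ^ 2 = 2 * N ^ 2 * c4 ^ 2)
    (hgh : -(wgh * aG * cG ^ 2) = 2 * N ^ 2 * c4 ^ 2) (cQ : ℝ) {lam lam' : Idx} (h : lam ≠ lam') {x : E4} (hx : x ≠ 0) :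
    x lam * x lam' * (wg * cL ^ 2 * (aB * bubble (cQ • bfGerm) (cQ • bfGerm) lam lam' x) - wgh * cG ^ 2 * (aG * ghostLoop lam lam' x))
      = leadingIntegrand ((10 * cQ ^ 2 + 1) / 11 * kappaBal N) lam lam' x := by
  rw [germPol_moment wg wgh aB aG cL cG cQ h hx, kappa_fixedLegs hg hgh cQ]

/-- [folklore] `(10·cQ² + 1)∕11 = cQ²` iff `cQ² = 1`. -/
theorem ratio_eq_sq_iff (cQ : ℝ) : (10 * cQ ^ 2 + 1) / 11 = cQ ^ 2 ↔ cQ ^ 2 = 1 := by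
  constructor <;> intro h <;> linarith

/-- [folklore] The off-diagonal (1.22)-moment of ANY member of the covariant family reads only its `x_μx_ν` coefficient:
`x_μx_ν·S^{a,b}_{μν}(x) = leadingIntegrand (b∕24) μ ν x` (`μ ≠ ν`; the `δ_{μν}a∕r2³` part is invisible off the diagonal). -/
theorem covFamily_offDiag_moment (a b : ℝ) {μ ν : Idx} (h : μ ≠ ν) (x : E4) :
    x μ * x ν * covFamily a b μ ν x = leadingIntegrand (b / 24) μ ν x := by
  rw [covFamily, if_neg h, add_zero, leadingIntegrand_apply, transverseUnit, ← r2_eq_normSq]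
  ring

/-- [folklore] **(c) UNMATCHED SLICE** (germ `cQ•ymGerm + sliceGerm = famGerm cQ 1`, i.e. H2V-1's `cQ·ymGerm` plus the CANONICAL slice of weight `1`): the gluon germ loop
`¼·bubble = covFamily (−20cQ² − 20cQ) (44cQ² + 32cQ + 4)` (`quarter_bubble_fam`) is divergence-free on `ℝ⁴ ∖ 0` **iff `cQ = 1`** (`fam_divFree_iff`). -/
theorem unmatched_divFree_iff (cQ : ℝ) :
    (∀ x : E4, x ≠ 0 → ∀ ν : Fin 4,
        ∑ μ, divTerm (-(20 * cQ ^ 2) - 20 * cQ * 1) (44 * cQ ^ 2 + 32 * cQ * 1 + 4 * 1 ^ 2) μ ν x = 0) ↔ cQ = 1 := by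
  rw [fam_divFree_iff cQ 1]; exact eq_comm

/-- [folklore] **… yet its OFF-DIAGONAL moment is still a leading germ**: `x_λx_{λ′}·¼·bubble (famGerm cQ 1)² = leadingIntegrand ((11cQ² + 8cQ + 1)∕6) λ λ′ x` (`λ ≠ λ′`,
`z ≠ 0`) — against the matched `(10∕3)·cQ²` (`matched_gluon_moment`); the two agree at `cQ = 1` (both `10∕3`). -/
theorem unmatched_gluon_moment (cQ : ℝ) {lam lam' : Idx} (h : lam ≠ lam') {x : E4} (hx : x ≠ 0) :
    x lam * x lam' * ((1 / 4 : ℝ) * bubble (famGerm cQ 1) (famGerm cQ 1) lam lam' x)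
      = leadingIntegrand ((11 * cQ ^ 2 + 8 * cQ + 1) / 6) lam lam' x := by
  rw [quarter_bubble_fam cQ 1 lam lam' hx, covFamily_offDiag_moment _ _ h]
  congr 1; ring

/-- [folklore] the matched counterpart: `x_λx_{λ′}·¼·bubble (cQ•bfGerm)² = leadingIntegrand ((10∕3)·cQ²) λ λ′ x` (`λ ≠ λ′`, `z ≠ 0`). -/
theorem matched_gluon_moment (cQ : ℝ) {lam lam' : Idx} (h : lam ≠ lam') {x : E4} (hx : x ≠ 0) :
    x lam * x lam' * ((1 / 4 : ℝ) * bubble (cQ • bfGerm) (cQ • bfGerm) lam lam' x)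
      = leadingIntegrand (10 / 3 * cQ ^ 2) lam lam' x := by
  rw [bubble_smul_bfGerm cQ lam lam' hx, ← smul_moment_eq_leadingIntegrand h]
  ring

/-- [folklore] **AT `cQ = 1` ALL READINGS COINCIDE** and the germ is `bfGerm` itself: `(1:ℝ)•bfGerm = bfGerm`, `famGerm 1 1 = bfGerm`; the END face is then literally
`wg·cL²·(aB·bubble bfGerm bfGerm) − wgh·cG²·(aG·ghostLoop) = 2N²c₄²·(¼·bubble bfGerm bfGerm + ghostLoop)` under `4·wg·aB·cL² = 2N²c₄²`, `−wgh·aG·cG² = 2N²c₄²`. -/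
theorem germPol_eq_an3_one {wg wgh aB aG cL cG N : ℝ} (hg : 4 * wg * aB * cL ^ 2 = 2 * N ^ 2 * c4 ^ 2)
    (hgh : -(wgh * aG * cG ^ 2) = 2 * N ^ 2 * c4 ^ 2) (lam lam' : Idx) {x : E4} (hx : x ≠ 0) :
    wg * cL ^ 2 * (aB * bubble bfGerm bfGerm lam lam' x) - wgh * cG ^ 2 * (aG * ghostLoop lam lam' x)
      = 2 * N ^ 2 * c4 ^ 2 * ((1 / 4 : ℝ) * bubble bfGerm bfGerm lam lam' x + ghostLoop lam lam' x) := by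
  have h1 : (1 : ℝ) • bfGerm = bfGerm := one_smul ℝ bfGerm
  have hg' : 4 * wg * aB * (cL * 1) ^ 2 = 2 * N ^ 2 * c4 ^ 2 := by rw [mul_one]; exact hg
  have := germPol_eq_an3 hg' hgh lam lam' hx
  rwa [h1] at this

end

end Summit.QuantumFields.BalabanUV.Beta.FP.PolarizationColour
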